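import Literature.NumberTheory.EllipticCurves.IwasawaAlgebraInvolutionInvariantsProofs
import HarnessLib

/-!
# The fine-Selmer keying dictionary, completed: characteristic ideals, membership, `μ`, `λ` and the lengths at
# `ι`-fixed primes of a key-`γ` versus a key-`γ⁻¹` `FineSelmerDualData` (proofs only; 0 def, 0 fact)

Topic `NumberTheory/EllipticCurves`, sub-directory `Kato2004` (namespace = path). Sequel of
`Kato2004/IwasawaInvolutionTwistProofs.lean` §3 (the `γ ↦ γ⁻¹` re-keying of Kato's dual fine Selmer datum
`W.FineSelmerDualData κ γ` = `X₀(E/K_∞)` is its Iwasawa-involution twist: `fineSelmerDualData_exists_involTwist`,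
`fineSelmerDualData_lengthAt_inv_eq` — lengths only) and of `IwasawaAlgebraInvolutionInvariantsProofs.lean` (generic:
`μ`, `λ`, lengths at `ι`-fixed primes are twist-invariant). It supplies for the FINE dual exactly the entries the ♯/♭ dual got
in `Sprung2012/SharpFlatSelmerDualInvolutionTwistProofs.lean` §3–§4. THEOREMS ONLY: no definition, no named fact, no
`instance`, no `sorry`; nothing about Kato's Main Conjecture 12.10 or BSD is asserted.

For ANY `Y : W.FineSelmerDualData κ γ` and ANY `Y′ : W.FineSelmerDualData κ γ⁻¹` (uniqueness at each key,
`FineSelmerDualData.nonempty_linearEquiv`):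
* `fineSelmerDualData_charIdeal_inv_eq` — `char(Y′.X) = ι(char(Y.X))` (`Module.charIdeal_eq_map_of_semilinearEquiv`);
  `…_mem_charIdeal_inv_iff` / `…_iff_inv` (`f ∈ char Y′ ↔ ι f ∈ char Y`); `…_natCast_pow_mul_mem_charIdeal_inv_iff`
  (`pⁿ f ∈ char Y′ ↔ pⁿ ι f ∈ char Y` — the shape of Kato's Thm. 12.5 (4) divisibility);
* `fineSelmerDualData_mu_inv_eq`, `fineSelmerDualData_lambda_inv_eq` — `μ(Y′.X) = μ(Y.X)`, `λ(Y′.X) = λ(Y.X)`: the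
  `μ`-invariant (Coates–Sujatha Conjecture A currency; the `MuTransfer` cruxes) and `λ` of `X₀` are KEYING-IMMUNE;
* `fineSelmerDualData_lengthAt_inv_eq_of_comap_invol_eq` (+ `…_primeT_…`, `…_of_asIdeal_eq_augIdealP`) — at an
  `ι`-fixed prime the two keyings have the same local length.

References: K. Kato, Astérisque 295 (2004) §12.2 (p. 220), Conj. 12.10 (p. 224), §17.13 (p. 279) [Kato2004Asterisque];
R. Greenberg, Adv. Stud. Pure Math. 17 (1989) §0 pp. 101–102 [Greenberg1989]; R. Greenberg, LNM 1716 §1 p. 60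
[GreenbergLNM1716]; J. Coates, R. Sujatha, Math. Ann. 331 (2005) §3 [CoatesSujatha2005]; L. Washington, GTM 83, §13.2
[Washington1997].
-/

noncomputable section

open scoped NumberField
open Field
open Literature.NumberTheory.EllipticCurves Literature.NumberTheory.EllipticCurves.IwasawaAlgebra

namespace Literature.NumberTheory.EllipticCurves.Kato2004

universe u

variable {K : Type u} [Field K] [NumberField K] {W : WeierstrassCurve K} {p : ℕ} [Fact p.Prime]
  {κ : ZpExtension K p} {γ : Field.absoluteGaloisGroup K}

/-- **`char(Y′.X) = ι(char(Y.X))`** for ANY dual fine Selmer data `Y` of key `γ` and `Y′` of key `γ⁻¹`: the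
characteristic ideal of the contragredient `X₀` is the `ι`-image of that of the tree-keyed one
("`Char(M^ι) = ι(Char M)`" along the twist of `fineSelmerDualData_exists_involTwist`, plus uniqueness at key `γ⁻¹`).
[cite: GreenbergLNM1716, §1 (p. 60)] [cite: Washington1997, §13.2] [cite: Kato2004Asterisque, Conj. 12.10 (p. 224) (the object only)] -/
theorem fineSelmerDualData_charIdeal_inv_eq (Y : W.FineSelmerDualData κ γ) (Y' : W.FineSelmerDualData κ γ⁻¹) :
    Y'.charIdeal = Y.charIdeal.map (invol p).toRingHom := by
  obtain ⟨Y₁, e, he, -⟩ := fineSelmerDualData_exists_involTwist (mul_inv_cancel γ) Y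
  obtain ⟨e'⟩ := WeierstrassCurve.FineSelmerDualData.nonempty_linearEquiv Y' Y₁
  have h1 : Y'.charIdeal = Y₁.charIdeal := Module.charIdeal_eq_of_linearEquiv e'
  rw [h1]
  exact Module.charIdeal_eq_map_of_semilinearEquiv
    (involEquiv p : IwasawaAlgebra p ≃+* IwasawaAlgebra p) e (fun r m ↦ he r m)

/-- Membership form: **`f ∈ char(Y′.X) ↔ ι f ∈ char(Y.X)`** (`ι` is an involution, so `map ι = comap ι`).
[cite: GreenbergLNM1716, §1 (p. 60)] [cite: Washington1997, §13.2] -/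
theorem fineSelmerDualData_mem_charIdeal_inv_iff (Y : W.FineSelmerDualData κ γ) (Y' : W.FineSelmerDualData κ γ⁻¹)
    (f : IwasawaAlgebra p) : f ∈ Y'.charIdeal ↔ invol p f ∈ Y.charIdeal := by
  rw [fineSelmerDualData_charIdeal_inv_eq Y Y']
  have hmap : Y.charIdeal.map (invol p).toRingHom = Y.charIdeal.comap (invol p).toRingHom := by
    have h1 : Y.charIdeal.map ((involEquiv p : IwasawaAlgebra p ≃+* IwasawaAlgebra p) :
        IwasawaAlgebra p →+* IwasawaAlgebra p) =
        Y.charIdeal.comap ((involEquiv p).symm : IwasawaAlgebra p ≃+* IwasawaAlgebra p) :=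
      Ideal.map_comap_of_equiv _
    exact h1
  rw [hmap, Ideal.mem_comap]
  rfl

/-- The membership dictionary read from the tree-keyed side: `f ∈ char(Y.X) ↔ ι f ∈ char(Y′.X)`.
[cite: GreenbergLNM1716, §1 (p. 60)] -/
theorem fineSelmerDualData_mem_charIdeal_iff_inv (Y : W.FineSelmerDualData κ γ) (Y' : W.FineSelmerDualData κ γ⁻¹)
    (f : IwasawaAlgebra p) : f ∈ Y.charIdeal ↔ invol p f ∈ Y'.charIdeal := by
  rw [fineSelmerDualData_mem_charIdeal_inv_iff Y Y', invol_invol]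

/-- The `pⁿ`-twisted membership door (the shape of Kato's divisibility `pⁿ · f ∈ char X₀`, Thm. 12.5 (4)):
`pⁿ · f ∈ char(Y′.X) ↔ pⁿ · ι f ∈ char(Y.X)` (`ι` fixes the constant `p`).
[cite: Kato2004Asterisque, Thm. 12.5 (4) (p. 222) (the shape only)] [cite: GreenbergLNM1716, §1 (p. 60)] -/
theorem fineSelmerDualData_natCast_pow_mul_mem_charIdeal_inv_iff (Y : W.FineSelmerDualData κ γ)
    (Y' : W.FineSelmerDualData κ γ⁻¹) (n : ℕ) (f : IwasawaAlgebra p) :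
    (p : IwasawaAlgebra p) ^ n * f ∈ Y'.charIdeal ↔ (p : IwasawaAlgebra p) ^ n * invol p f ∈ Y.charIdeal := by
  rw [fineSelmerDualData_mem_charIdeal_inv_iff Y Y', map_mul, map_pow, map_natCast]

/-- **`μ(X₀)` is keying-immune**: `μ(Y′.X) = μ(Y.X)` for ANY `Y` of key `γ` and `Y′` of key `γ⁻¹` (twist +
uniqueness + `muInvariant_eq_of_involSemilinear`; `ι` fixes the prime `(p)`). The currency of Coates–Sujatha
Conjecture A / the `μ`-transfer statements is the same in either keying. [cite: CoatesSujatha2005, §3 (Conjecture A, the invariant only)]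
[cite: Washington1997, §13.2] -/
theorem fineSelmerDualData_mu_inv_eq (Y : W.FineSelmerDualData κ γ) (Y' : W.FineSelmerDualData κ γ⁻¹) :
    muInvariant p Y'.X = muInvariant p Y.X := by
  obtain ⟨Y₁, e, he, -⟩ := fineSelmerDualData_exists_involTwist (mul_inv_cancel γ) Y
  obtain ⟨e'⟩ := WeierstrassCurve.FineSelmerDualData.nonempty_linearEquiv Y' Y₁
  rw [muInvariant_eq_of_linearEquiv e']
  exact muInvariant_eq_of_involSemilinear e he

/-- **`λ(X₀)` is keying-immune**: `λ(Y′.X) = λ(Y.X)` for ANY `Y` of key `γ` and `Y′` of key `γ⁻¹`.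
[cite: Washington1997, §13.2] [cite: GreenbergLNM1716, §1 (p. 60)] -/
theorem fineSelmerDualData_lambda_inv_eq (Y : W.FineSelmerDualData κ γ) (Y' : W.FineSelmerDualData κ γ⁻¹) :
    lambdaInvariant p Y'.X = lambdaInvariant p Y.X := by
  obtain ⟨Y₁, e, he, -⟩ := fineSelmerDualData_exists_involTwist (mul_inv_cancel γ) Y
  obtain ⟨e'⟩ := WeierstrassCurve.FineSelmerDualData.nonempty_linearEquiv Y' Y₁
  rw [lambdaInvariant_eq_of_linearEquiv e']
  exact lambdaInvariant_eq_of_involSemilinear e he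

/-- **At an `ι`-fixed prime the two keyings of `X₀` have the same local length**: `ι𝔓 = 𝔓 ⟹ ℓ_𝔓(Y′.X) = ℓ_𝔓(Y.X)`.
[cite: GreenbergLNM1716, §1 (p. 60)] [cite: Washington1997, §13.2] -/
theorem fineSelmerDualData_lengthAt_inv_eq_of_comap_invol_eq (Y : W.FineSelmerDualData κ γ)
    (Y' : W.FineSelmerDualData κ γ⁻¹) (𝔓 : PrimeSpectrum (IwasawaAlgebra p))
    (h𝔓 : PrimeSpectrum.comap (invol p).toRingHom 𝔓 = 𝔓) :
    Module.lengthAt (IwasawaAlgebra p) Y'.X 𝔓 = Module.lengthAt (IwasawaAlgebra p) Y.X 𝔓 := by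
  rw [fineSelmerDualData_lengthAt_inv_eq Y Y' 𝔓, h𝔓]

/-- The two keyings of `X₀` have the same length at the augmentation prime `(T)` (orders of vanishing at `T = 0` —
the rank / leading-term bookkeeping of Kato's descent — are keying-insensitive). [cite: Washington1997, §13.2]
[cite: Kato2004Asterisque, §14.14 (descent at T) (context)] -/
theorem fineSelmerDualData_lengthAt_primeT_inv_eq (Y : W.FineSelmerDualData κ γ) (Y' : W.FineSelmerDualData κ γ⁻¹) :
    Module.lengthAt (IwasawaAlgebra p) Y'.X (primeT p) = Module.lengthAt (IwasawaAlgebra p) Y.X (primeT p) :=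
  fineSelmerDualData_lengthAt_inv_eq_of_comap_invol_eq Y Y' (primeT p) (comap_invol_primeT p)

/-- The two keyings of `X₀` have the same length at the prime `(p)`. [cite: Washington1997, §13.2] -/
theorem fineSelmerDualData_lengthAt_inv_eq_of_asIdeal_eq_augIdealP (Y : W.FineSelmerDualData κ γ)
    (Y' : W.FineSelmerDualData κ γ⁻¹) (𝔓 : PrimeSpectrum (IwasawaAlgebra p)) (h𝔓 : 𝔓.asIdeal = augIdealP p) :
    Module.lengthAt (IwasawaAlgebra p) Y'.X 𝔓 = Module.lengthAt (IwasawaAlgebra p) Y.X 𝔓 :=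
  fineSelmerDualData_lengthAt_inv_eq_of_comap_invol_eq Y Y' 𝔓
    (comap_invol_eq_self_of_asIdeal_eq_augIdealP p 𝔓 h𝔓)

end Literature.NumberTheory.EllipticCurves.Kato2004

end
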